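import Summits.Schanuel.Schanuel.Theorems.RootDecomp1KHyper60

/-!
# RootDecomp1KHyper — lens 6, generation 17 «BILOG STAIRCASE CELL» (BilogStair.lean edition 2 f0528a77…, 2567 l) — continuation (RootDecomp1KHyper61): §I first part: `flat_contra_complex` and the Case II preparations

(lens-6 g17 `BilogStair.lean` edition 2, sha256 f0528a77…5850, own farm rc 0 · 0 sorry · axioms std; critic ACK STATUS L1737 PORT GO LOW (registered, no credit);
port by census-1 gen 15 in ten parts `RootDecomp1KHyper53`–`62` — see the PORT NOTE of part 53; `--supports stmt-Schanuel-33363`; rung 0.)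
-/

open Complex Polynomial IntermediateField Filter
open scoped BigOperators

namespace Summit.Schanuel.Schanuel.Theorems.RootDecomp1KHyper

namespace HyperCell

namespace LatCell

namespace Bilog

variable {n : ℕ}
open Summit.Schanuel.Schanuel.Theorems.RootDecomp1KRelLiouvilleCell (mvPolyMeasure_one_of_polyMeasure)

/-! ## §I  The exp-free rung of Case II: `Φ(π, ℓ) = 0 ⇒ (π, y)` algebraically independent -/

/-- Hyper-smallness beats any polynomial: `C₀ H^N ε < 1` once `ε < exp(-H^{m₀})`, `H ≥ 3`. -/
theorem exists_exp_beats (C₀ : ℝ) (N : ℕ) :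
    ∃ m₀ : ℕ, ∀ H ε : ℝ, 3 ≤ H → 0 ≤ ε → ε < Real.exp (-H ^ m₀) → C₀ * H ^ N * ε < 1 := by
  obtain ⟨M, hM⟩ := pow_unbounded_of_one_lt C₀ (by norm_num : (1 : ℝ) < 3)
  refine ⟨N + M, fun H ε hH hε hlt => ?_⟩
  have hH0 : 0 ≤ H := by linarith
  by_cases hC : C₀ ≤ 0
  · have : C₀ * H ^ N * ε ≤ 0 :=
      mul_nonpos_of_nonpos_of_nonneg (mul_nonpos_of_nonpos_of_nonneg hC (pow_nonneg hH0 N)) hε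
    linarith
  push Not at hC
  have hHM : C₀ ≤ H ^ M := hM.le.trans (pow_le_pow_left₀ (by norm_num) hH M)
  have h1 : C₀ * H ^ N < Real.exp (H ^ (N + M)) := by
    calc C₀ * H ^ N ≤ H ^ M * H ^ N := by gcongr
      _ = H ^ (N + M) := by rw [pow_add, mul_comm]
      _ < H ^ (N + M) + 1 := lt_add_one _
      _ ≤ Real.exp (H ^ (N + M)) := Real.add_one_le_exp _
  have h2 : 0 ≤ C₀ * H ^ N := by positivity
  calc C₀ * H ^ N * ε ≤ C₀ * H ^ N * Real.exp (-H ^ (N + M)) := by gcongr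
    _ < Real.exp (H ^ (N + M)) * Real.exp (-H ^ (N + M)) := by gcongr
    _ = 1 := by rw [← Real.exp_add, add_neg_cancel, Real.exp_zero]

/-- Evaluation after a substitution with complex coefficients. -/
theorem eval_aeval_C {σ τ : Type*} (w : σ → MvPolynomial τ ℂ) (x : τ → ℂ) (p : MvPolynomial σ ℂ) :
    MvPolynomial.eval x (MvPolynomial.aeval w p) = MvPolynomial.eval (fun i => MvPolynomial.eval x (w i)) p := by
  change MvPolynomial.eval₂Hom (RingHom.id ℂ) x (MvPolynomial.bind₁ w p) = _
  rw [MvPolynomial.eval₂Hom_bind₁]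
  rfl

/-- **Staircase lemma, complex coefficients.**  Along a flat staircase no fixed non-zero `h ∈ ℂ[u, v]` vanishes
at `(a_k, b_k)` for all large `k` (real and imaginary parts + `staircase_eval_ne_zero`). -/
theorem flat_contra_complex {a b : ℕ → ℚ} {Y₁ Y₂ : ℝ} (hflat : Flat a b Y₁ Y₂) (h : MvPolynomial (Fin 2) ℂ)
    (hh : h ≠ 0) (hz : ∀ᶠ k in atTop, MvPolynomial.eval ![(a k : ℂ), (b k : ℂ)] h = 0) : False := by
  classical
  set hs : MvPolynomial (Fin 2) ℂ := MvPolynomial.aeval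
    (![MvPolynomial.C (Y₁ : ℂ) - MvPolynomial.X 0, MvPolynomial.C (Y₂ : ℂ) - MvPolynomial.X 1] :
      Fin 2 → MvPolynomial (Fin 2) ℂ) h with hsdef
  have hev : ∀ u v : ℂ, MvPolynomial.eval ![u, v] hs = MvPolynomial.eval ![(Y₁ : ℂ) - u, (Y₂ : ℂ) - v] h := by
    intro u v
    rw [hsdef, eval_aeval_C]
    have hfun : (fun i => MvPolynomial.eval ![u, v]
        ((![MvPolynomial.C (Y₁ : ℂ) - MvPolynomial.X 0, MvPolynomial.C (Y₂ : ℂ) - MvPolynomial.X 1] :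
          Fin 2 → MvPolynomial (Fin 2) ℂ) i)) = ![(Y₁ : ℂ) - u, (Y₂ : ℂ) - v] := by
      funext i
      match i with
      | 0 => simp
      | 1 => simp
    rw [hfun]
  have hs0 : hs ≠ 0 := by
    intro h0
    apply hh
    refine MvPolynomial.funext fun x => ?_
    rw [map_zero]
    have hx : x = ![(Y₁ : ℂ) - ((Y₁ : ℂ) - x 0), (Y₂ : ℂ) - ((Y₂ : ℂ) - x 1)] := by
      funext i
      match i with
      | 0 => simp
      | 1 => simp
    rw [hx, ← hev, h0, map_zero]
  set hre : MvPolynomial (Fin 2) ℝ := ∑ d ∈ hs.support, MvPolynomial.monomial d (hs.coeff d).re with hre_def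
  set him : MvPolynomial (Fin 2) ℝ := ∑ d ∈ hs.support, MvPolynomial.monomial d (hs.coeff d).im with him_def
  have hcoeff_re : ∀ m, hre.coeff m = (hs.coeff m).re := by
    intro m
    rw [hre_def, MvPolynomial.coeff_sum]
    simp_rw [MvPolynomial.coeff_monomial]
    rw [Finset.sum_ite_eq']
    split_ifs with hm
    · rfl
    · rw [MvPolynomial.notMem_support_iff.mp hm, Complex.zero_re]
  have hcoeff_im : ∀ m, him.coeff m = (hs.coeff m).im := by
    intro m
    rw [him_def, MvPolynomial.coeff_sum]
    simp_rw [MvPolynomial.coeff_monomial]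
    rw [Finset.sum_ite_eq']
    split_ifs with hm
    · rfl
    · rw [MvPolynomial.notMem_support_iff.mp hm, Complex.zero_im]
  have heval : ∀ u v : ℝ, ((MvPolynomial.eval ![u, v] hre : ℝ) : ℂ) + (MvPolynomial.eval ![u, v] him : ℂ) * I =
      MvPolynomial.eval ![(u : ℂ), (v : ℂ)] hs := by
    intro u v
    have hcast : ∀ d : Fin 2 →₀ ℕ, (((d.prod fun i e => (![u, v] i) ^ e : ℝ)) : ℂ) =
        d.prod fun i e => (![(u : ℂ), (v : ℂ)] i) ^ e := by
      intro d
      rw [Finsupp.prod, Finsupp.prod]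
      push_cast
      refine Finset.prod_congr rfl fun i _ => ?_
      congr 1
      match i with
      | 0 => simp
      | 1 => simp
    conv_rhs => rw [hs.as_sum]
    rw [hre_def, him_def, map_sum, map_sum, map_sum]
    simp only [MvPolynomial.eval_monomial, Complex.ofReal_sum, Complex.ofReal_mul, hcast, Finset.sum_mul,
      ← Finset.sum_add_distrib]
    refine Finset.sum_congr rfl fun d _ => ?_
    calc ((hs.coeff d).re : ℂ) * (d.prod fun i e => (![(u : ℂ), (v : ℂ)] i) ^ e) +
          ((hs.coeff d).im : ℂ) * (d.prod fun i e => (![(u : ℂ), (v : ℂ)] i) ^ e) * I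
        = (((hs.coeff d).re : ℂ) + ((hs.coeff d).im : ℂ) * I) * (d.prod fun i e => (![(u : ℂ), (v : ℂ)] i) ^ e) := by
          ring
      _ = hs.coeff d * (d.prod fun i e => (![(u : ℂ), (v : ℂ)] i) ^ e) := by rw [Complex.re_add_im]
  -- one of the two real parts is non-zero
  obtain ⟨m, hm⟩ := MvPolynomial.ne_zero_iff.mp hs0
  have hP : ∃ P : MvPolynomial (Fin 2) ℝ, P ≠ 0 ∧
      ∀ u v : ℝ, MvPolynomial.eval ![(u : ℂ), (v : ℂ)] hs = 0 → MvPolynomial.eval ![u, v] P = 0 := by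
    have hparts : ∀ u v : ℝ, MvPolynomial.eval ![(u : ℂ), (v : ℂ)] hs = 0 →
        MvPolynomial.eval ![u, v] hre = 0 ∧ MvPolynomial.eval ![u, v] him = 0 := by
      intro u v h0
      have h1 := heval u v
      rw [h0] at h1
      have h2 := congrArg Complex.re h1
      have h3 := congrArg Complex.im h1
      simp at h2 h3
      exact ⟨h2, h3⟩
    by_cases hre0 : (hs.coeff m).re = 0
    · have him0 : (hs.coeff m).im ≠ 0 := by
        intro h0
        exact hm (Complex.ext hre0 h0)
      refine ⟨him, fun h0 => him0 ?_, fun u v huv => (hparts u v huv).2⟩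
      rw [← hcoeff_im, h0, MvPolynomial.coeff_zero]
    · refine ⟨hre, fun h0 => hre0 ?_, fun u v huv => (hparts u v huv).1⟩
      rw [← hcoeff_re, h0, MvPolynomial.coeff_zero]
  obtain ⟨P, hP0, hPev⟩ := hP
  obtain ⟨M, δ, hδ, hstair⟩ := staircase_eval_ne_zero P hP0
  obtain ⟨k, ⟨h1, h2, h3, h4⟩, hk⟩ := ((hflat M δ hδ).and_eventually hz).exists
  refine hstair (Y₁ - a k) (Y₂ - b k) h1 h2 h3 h4 (hPev _ _ ?_)
  rw [hev]
  have e1 : (Y₁ : ℂ) - ((Y₁ - (a k : ℝ) : ℝ) : ℂ) = (a k : ℂ) := by push_cast; ring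
  have e2 : (Y₂ : ℂ) - ((Y₂ - (b k : ℝ) : ℝ) : ℂ) = (b k : ℂ) := by push_cast; ring
  rw [e1, e2]
  exact hk

end Bilog
end LatCell
end HyperCell
end Summit.Schanuel.Schanuel.Theorems.RootDecomp1KHyper
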